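import Literature.AlgebraicGeometry.Resolution.QuadraticTransforms
import Literature.AlgebraicGeometry.Resolution.BlowupChartRegular
import Literature.AlgebraicGeometry.Resolution.RegularSystemOfParameters
import Literature.AlgebraicGeometry.Resolution.RegularLocalRingsNormal
import Literature.AlgebraicGeometry.Resolution.AdicCompletionRegular
import HarnessLib

/-!
# Quadratic transforms along a valuation of a regular local ring are regular

Topic: `Literature/AlgebraicGeometry/Resolution`. A PROVED structural fact about the sequence of
quadratic transforms along a valuation (`QuadraticTransforms.lean`: `IsQuadraticTransformAlong`,
`blowupRing R x = R[m_R/x] ⊆ K`, `locAtCentre`), needed for Abhyankar's union lemma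
(`AbhyankarQuadraticUnion`; Abhyankar 1956, Lemma 12, via his Lemma 7 which wants the members
of the sequence NORMAL): **if `R ⊆ K` is a regular local ring then so is its quadratic transform
`R₁` along a valuation ring `O ⊇ R`** (Abhyankar 1959, Lemma 3.20: "`(S, N)` is a regular local
domain of dimension `t ≤ s`"; Huneke–Swanson Ex. 9.8 (i)), hence `R₁` is integrally closed.

Proof: choose a regular system of parameters `x` of `R` and an `x_i` of minimal value; by the
uniqueness of the transform along `O` (`IsQuadraticTransformAlong.unique`),
`R₁ = (R[m/x_i])_{m_O ∩ R[m/x_i]}`. The ring `R[m/x_i] ⊆ K` is the image of the chart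
`(R[mt])_{(x_i t)}` of the blowing up of `Spec R` at the closed point, which is a regular ring
(`isRegularRing_blowupChart`: the chart of the blowing up of a regular ring along a quasi-regular
sequence with regular quotient is regular; a regular system of parameters is quasi-regular,
`isQuasiRegular_regularSystemOfParameters`; `R/m` is a field); the chart maps isomorphically
onto `R[m/x_i]` (`isRegularRing_closure_of_isRegularRing_blowupChart`: generated by the `x_j/x_i`,
and injective because `x_i` is a nonzerodivisor on the chart); a localisation of a regular ring at a
prime is regular.

* `isRegularRing_closure_of_isRegularRing_blowupChart` — `(R[It])_{(x_i t)} ≅ R[I/x_i] ⊆ K` for a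
  domain `R ⊆ K`, so the latter is regular when the former is;
* `isRegularRing_blowupRing` — `R[m/x_i]` is a regular ring;
* `IsQuadraticTransformAlong.isRegularLocalRing_of_isRegularLocalRing` — the theorem;
* `isIntegrallyClosedIn_of_isRegularLocalRing` — regular local subrings with fraction field `K`
  are integrally closed in `K` (Matsumura Thm. 19.4, `RegularLocalRingsNormal.lean`).

## Sources

* S. S. Abhyankar, *Ramification theoretic methods in algebraic geometry* (1959), Lemma 3.20
  (p. 73). [cite: Abhyankar1959, Lemma 3.20]
* S. S. Abhyankar, Amer. J. Math. 78 (1956), Prop. 8 (as reported in Huneke–Swanson,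
  Exercise 9.8 (i)). [cite: Abhyankar1956Valuations, Prop. 8]
* The Stacks Project, Tag 0804 (affine blowup algebras). [cite: StacksProject, Tag 0804]
-/

noncomputable section

namespace Literature.AlgebraicGeometry.Resolution

universe u

open IsLocalRing

variable {K : Type u} [Field K]

/-! ## The chart of the blowing up inside `K` -/

section Chart

variable {A : Type u} [CommRing A] (f : A →+* K) {r : ℕ} (x : Fin r → A) (i : Fin r)

local notation3 "I" => Ideal.span (Set.range x)
local notation3 "B" => HomogeneousLocalization.Away (reesGrading I)
  (reesT (x i) (Ideal.mem_span_range_self (f := x) (x := i)))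
local notation3 "φ" => reesChartBase (x i) (Ideal.mem_span_range_self (f := x) (x := i))
local notation3 "e[" j "]" =>
  HomogeneousLocalization.Away.mk (reesGrading I)
    (reesT_mem (x i) (Ideal.mem_span_range_self (f := x) (x := i))) 1
    (reesT (x j) (Ideal.mem_span_range_self (f := x) (x := j))) (reesT_mem_one_smul x j)

/-- **The chart of the blowing up, realised in `K`, is regular when the chart ring is.** For a
ring `A` embedded in a field `K` by `f`, a family `x` of elements of `A` with `f(x_i) ≠ 0`, and
`I = (x)`: the chart ring `(A[It])_{(x_i t)}` of `Bl_I(Spec A)` maps isomorphically onto the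
subring `A[I/x_i]` of `K` generated by `f(A)` and the `x_j/x_i`, by `(y tⁿ)/(x_i t)ⁿ ↦ y/x_iⁿ`
(Stacks 0804: for a domain the affine blowup algebra `A[I/a]` is the subring of `Frac A`
generated by the `y/a`; injectivity because `x_i` is a nonzerodivisor on the chart); hence
`A[I/x_i]` is a regular ring if the chart ring is. [cite: StacksProject, Tag 0804] -/
theorem isRegularRing_closure_of_isRegularRing_blowupChart (hf : Function.Injective f)
    (hxi : f (x i) ≠ 0) (hB : IsRegularRing B) :
    IsRegularRing (Subring.closure ((f.range : Set K) ∪ Set.range fun j => f (x j) / f (x i))) := by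
  classical
  set C := Subring.closure ((f.range : Set K) ∪ Set.range fun j => f (x j) / f (x i)) with hC
  have hunit : IsUnit (f (x i)) := isUnit_iff_ne_zero.mpr hxi
  -- `ψ : B → A[1/x_i] → K`
  set ψ : B →+* K := (IsLocalization.Away.lift (x i) hunit :
      Localization.Away (x i) →+* K).comp (reesChart (x i) (Ideal.mem_span_range_self (f := x) (x := i)))
    with hψ
  have hψφ : ∀ a : A, ψ (φ a) = f a := by
    intro a
    rw [hψ, RingHom.comp_apply, reesChart_reesChartBase, IsLocalization.Away.lift_eq]
  have hψe : ∀ j, ψ (e[j]) = f (x j) / f (x i) := by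
    intro j
    have h := congrArg ψ (reesChartBase_apply_eq_mul_chartGen x i j)
    rw [map_mul, hψφ, hψφ] at h
    rw [eq_div_iff hxi, mul_comm]
    exact h.symm
  -- the range of `ψ` is `C`
  have hrange_le : ∀ z : B, ψ z ∈ C := by
    intro z
    obtain ⟨n, F, -, rfl⟩ := exists_isHomogeneous_eval₂_eq x i z
    change (ψ.comp (MvPolynomial.eval₂Hom φ fun j => e[j])) F ∈ C
    rw [MvPolynomial.comp_eval₂Hom]
    induction F using MvPolynomial.induction_on with
    | C a =>
      rw [MvPolynomial.eval₂Hom_C, RingHom.comp_apply, hψφ]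
      exact Subring.subset_closure (Or.inl ⟨a, rfl⟩)
    | add p q hp hq => rw [map_add]; exact C.add_mem hp hq
    | mul_X p j hp =>
      rw [map_mul, MvPolynomial.eval₂Hom_X']
      refine C.mul_mem hp ?_
      change ψ (e[j]) ∈ C
      rw [hψe]
      exact Subring.subset_closure (Or.inr ⟨j, rfl⟩)
  have hle_range : ∀ z ∈ C, ∃ w : B, ψ w = z := by
    intro z hz
    induction hz using Subring.closure_induction with
    | mem z hz =>
      rcases hz with ⟨a, rfl⟩ | ⟨j, rfl⟩
      · exact ⟨φ a, hψφ a⟩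
      · exact ⟨e[j], hψe j⟩
    | zero => exact ⟨0, map_zero ψ⟩
    | one => exact ⟨1, map_one ψ⟩
    | add a b _ _ ha hb =>
      obtain ⟨u, rfl⟩ := ha
      obtain ⟨w, rfl⟩ := hb
      exact ⟨u + w, map_add ψ u w⟩
    | neg a _ ha =>
      obtain ⟨u, rfl⟩ := ha
      exact ⟨-u, map_neg ψ u⟩
    | mul a b _ _ ha hb =>
      obtain ⟨u, rfl⟩ := ha
      obtain ⟨w, rfl⟩ := hb
      exact ⟨u * w, map_mul ψ u w⟩
  -- `ψ` is injective: write `z_k = F_k(e)` with forms of one degree `n`; then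
  -- `φ(F_k(x)) = φ(x_i)ⁿ z_k`, `F₁(x) = F₂(x)` in `A` (compare in `K`), and `φ(x_i)` is a
  -- nonzerodivisor on the chart
  have hform : ∀ (z : B) (m : ℕ), ∃ (n : ℕ) (F : MvPolynomial (Fin r) A), m ≤ n ∧
      F.IsHomogeneous n ∧ MvPolynomial.eval₂Hom φ (fun j => e[j]) F = z := by
    intro z m
    obtain ⟨n, F, hF, hFz⟩ := exists_isHomogeneous_eval₂_eq x i z
    refine ⟨m + n, MvPolynomial.X i ^ m * F, Nat.le_add_right m n,
      (MvPolynomial.isHomogeneous_X_pow i m).mul hF, ?_⟩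
    rw [map_mul, map_pow, MvPolynomial.eval₂Hom_X', hFz]
    exact chartGen_self_pow_mul x i m z
  have hinj : Function.Injective ψ := by
    intro z₁ z₂ hz
    obtain ⟨n₁, F₁, -, hF₁, rfl⟩ := hform z₁ 0
    obtain ⟨n, F₂, hle, hF₂, rfl⟩ := hform z₂ n₁
    obtain ⟨k, rfl⟩ := Nat.exists_eq_add_of_le hle
    have hG₁hom : (MvPolynomial.X i ^ k * F₁).IsHomogeneous (n₁ + k) := by
      rw [add_comm]
      exact (MvPolynomial.isHomogeneous_X_pow i k).mul hF₁
    have hG₁e : MvPolynomial.eval₂Hom φ (fun j => e[j]) (MvPolynomial.X i ^ k * F₁) =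
        MvPolynomial.eval₂Hom φ (fun j => e[j]) F₁ := by
      rw [map_mul, map_pow, MvPolynomial.eval₂Hom_X']
      exact chartGen_self_pow_mul x i k _
    have h1 := reesChartBase_eval_eq_pow_mul_eval₂ x i hG₁hom
    have h2 := reesChartBase_eval_eq_pow_mul_eval₂ x i hF₂
    rw [hG₁e] at h1
    -- compare in `K`
    have hK : f (MvPolynomial.eval x (MvPolynomial.X i ^ k * F₁)) = f (MvPolynomial.eval x F₂) := by
      rw [← hψφ, ← hψφ, h1, h2, map_mul, map_mul, hz]
    have hA : MvPolynomial.eval x (MvPolynomial.X i ^ k * F₁) = MvPolynomial.eval x F₂ := hf hK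
    have h3 : φ (x i) ^ (n₁ + k) * MvPolynomial.eval₂Hom φ (fun j => e[j]) F₁ =
        φ (x i) ^ (n₁ + k) * MvPolynomial.eval₂Hom φ (fun j => e[j]) F₂ := by
      rw [← h1, ← h2, hA]
    have hnzd : φ (x i) ^ (n₁ + k) ∈ nonZeroDivisors B :=
      pow_mem (reesChartBase_mem_nonZeroDivisors (x i) (Ideal.mem_span_range_self (f := x) (x := i))) _
    exact (mul_cancel_left_mem_nonZeroDivisors hnzd).mp h3
  set ψ' : B →+* C := ψ.codRestrict C hrange_le with hψ'
  have hbij : Function.Bijective ψ' := by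
    constructor
    · intro a b hab
      exact hinj (congrArg Subtype.val hab)
    · rintro ⟨z, hz⟩
      obtain ⟨w, rfl⟩ := hle_range z hz
      exact ⟨w, rfl⟩
  let e := RingEquiv.ofBijective ψ' hbij
  exact IsRegularRing.of_ringEquiv e

end Chart

/-! ## Regularity -/

/-- **`R[m/x_i]` is a regular ring** for a regular local subring `R ⊆ K` and a member `x_i` of
a regular system of parameters `x` of `R`: it is the chart `(R[mt])_{(x_i t)}` of the blowing up
of the closed point, regular by `isRegularRing_blowupChart` (quasi-regularity of `x`, regularity
of `R` and of `R/m`). [cite: Abhyankar1959, Lemma 3.20] -/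
theorem isRegularRing_blowupRing (R : Subring K) [IsRegularLocalRing R] {d : ℕ}
    (hd : (maximalIdeal R).spanFinrank = d) (x : Fin d → R)
    (hx : Ideal.span (Set.range x) = maximalIdeal R) (i : Fin d) :
    IsRegularRing (blowupRing R (x i : K)) := by
  classical
  have hxi : x i ≠ 0 := by
    intro h
    have := not_mem_span_image_of_not_mem hd x hx (S := ∅) (i := i) (Set.notMem_empty i)
    rw [Set.image_empty, Ideal.span_empty, h] at this
    exact this (Submodule.zero_mem ⊥)
  haveI : IsRegularRing R := isRegularRing_of_isRegularLocalRing R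
  haveI : IsRegularRing (R ⧸ Ideal.span (Set.range x)) := by
    have hreg : IsRegularLocalRing (R ⧸ Ideal.span (x '' ((Finset.univ : Finset (Fin d)) : Set (Fin d)))) :=
      isRegularLocalRing_quotient_span_image hd x hx Finset.univ
    rw [Finset.coe_univ, Set.image_univ] at hreg
    exact isRegularRing_of_isRegularLocalRing _
  have hB := isRegularRing_blowupChart x i (isQuasiRegular_regularSystemOfParameters hd x hx)
  have hxi' : R.subtype (x i) ≠ 0 := fun h => hxi (Subtype.ext h)
  have hreg := isRegularRing_closure_of_isRegularRing_blowupChart R.subtype x i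
    Subtype.val_injective hxi' hB
  have hset : ((R.subtype.range : Set K) ∪ Set.range fun j => R.subtype (x j) / R.subtype (x i)) =
      (R : Set K) ∪ (fun y : R => (y : K) / (x i : K)) '' Set.range x := by
    rw [Subring.range_subtype, ← Set.range_comp]
    rfl
  rw [blowupRing_eq_closure_of_span_eq (x i : K) (Set.range x) hx, ← hset]
  exact hreg

/-- The local ring `B_{m_O ∩ B}` of a regular subring `B ⊆ O` at the centre of `O` is a regular
local ring. [folklore] -/
theorem isRegularLocalRing_locAtCentre_of_isRegularRing {B : Subring K} {O : ValuationSubring K}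
    (h : B ≤ O.toSubring) [IsRegularRing B] : IsRegularLocalRing (locAtCentre B O) :=
  (isRegularLocalRing_locAtCentre_iff h).mpr inferInstance

/-- **The quadratic transform along a valuation of a regular local ring is a regular local ring**
(Abhyankar 1959, Lemma 3.20; Abhyankar 1956, Prop. 8 / Huneke–Swanson Ex. 9.8 (i): "`R_{n+1}` is
a regular local ring"). If `R ⊆ K` is a regular local ring and `R₁` is its quadratic transform
along the valuation ring `O` (`IsQuadraticTransformAlong`), then `R₁` is a regular local ring:
`R₁ = (R[m/x_i])_{m_O ∩ R[m/x_i]}` for a member `x_i` of minimal value of a regular system of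
parameters (uniqueness of the transform), and `R[m/x_i]` is regular (`isRegularRing_blowupRing`).
[cite: Abhyankar1959, Lemma 3.20] [cite: Abhyankar1956Valuations, Prop. 8] -/
theorem IsQuadraticTransformAlong.isRegularLocalRing_of_isRegularLocalRing {O : ValuationSubring K}
    {R R₁ : Subring K} (h : IsQuadraticTransformAlong O R R₁) (hR : IsRegularLocalRing R) :
    IsRegularLocalRing R₁ := by
  classical
  have hRO := h.source_le
  obtain ⟨_, x₀, hx₀m, hx₀0, -, -⟩ := h.exists_eq_locAtCentre
  obtain ⟨x, hx⟩ := exists_regularSystemOfParameters (R := R)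
  -- some parameter is nonzero (as `m ≠ 0`)
  have hne : ∃ j ∈ (Finset.univ : Finset (Fin (maximalIdeal R).spanFinrank)), ((x j : R) : K) ≠ 0 := by
    by_contra hcon
    have hall : ∀ j, x j = 0 := fun j => by
      by_contra hj
      exact hcon ⟨j, Finset.mem_univ j, fun h0 => hj (Subtype.ext h0)⟩
    have hbot : Ideal.span (Set.range x) = ⊥ := by
      rw [Ideal.span_eq_bot]
      rintro _ ⟨j, rfl⟩
      exact hall j
    rw [hx] at hbot
    rw [hbot] at hx₀m
    exact hx₀0 ((Submodule.mem_bot _).mp hx₀m)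
  obtain ⟨i, -, hi0, hmax⟩ := exists_max_valuation O Finset.univ (fun j => ((x j : R) : K)) hne
  have hxi : x i ≠ 0 := fun h0 => hi0 (by rw [h0]; rfl)
  -- the transform along `O` in the `x_i`-chart
  have hspan : Ideal.span (↑(Finset.univ.image x) : Set R) = maximalIdeal R := by
    rw [Finset.coe_image, Finset.coe_univ, Set.image_univ, hx]
  have h' : IsQuadraticTransformAlong O R (locAtCentre (blowupRing R (x i : K)) O) := by
    refine ⟨‹_›, hRO, Finset.univ.image x, x i, hspan, Finset.mem_image_of_mem x (Finset.mem_univ i),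
      hxi, ?_, ?_⟩
    · intro y hy
      obtain ⟨j, -, rfl⟩ := Finset.mem_image.mp hy
      exact hmax j (Finset.mem_univ j)
    · rw [blowupRing_eq_closure_of_span_eq (x i : K) _ hspan]
  rw [h.unique h']
  haveI := isRegularRing_blowupRing R rfl x hx i
  exact isRegularLocalRing_locAtCentre_of_isRegularRing
    ((le_locAtCentre _ O).trans h'.target_le)

/-- Along a sequence of quadratic transforms along `O` starting from a regular local ring,
every member is a regular local ring. [cite: Abhyankar1956Valuations, Prop. 8] -/
theorem isRegularLocalRing_sequence {O : ValuationSubring K} {R : ℕ → Subring K}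
    (hreg : IsRegularLocalRing (R 0)) (hstep : ∀ i, IsQuadraticTransformAlong O (R i) (R (i + 1)))
    (n : ℕ) : IsRegularLocalRing (R n) := by
  induction n with
  | zero => exact hreg
  | succ n ih => exact (hstep n).isRegularLocalRing_of_isRegularLocalRing ih

/-- A regular local subring of `K` with fraction field `K` is integrally closed in `K`
(regular local rings are normal, Matsumura Thm. 19.4). [cite: Matsumura1987, Thm. 19.4] -/
theorem isIntegrallyClosedIn_of_isRegularLocalRing (R : Subring K) [IsRegularLocalRing R]
    [IsFractionRing R K] : IsIntegrallyClosedIn R K := by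
  haveI : IsDomain R := inferInstance
  haveI : IsIntegrallyClosed R := isIntegrallyClosed_of_isRegularLocalRing R
  exact (isIntegrallyClosed_iff_isIntegrallyClosedIn K).mp ‹_›

end Literature.AlgebraicGeometry.Resolution

end
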